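import Summits.CriticalPhenomena.PercolationContinuityZ3.Theorems.Transplant.CayleySkeletonAbelian
import Mathlib.Algebra.BigOperators.Pi
import HarnessLib

/-!
# `θ(p_c) = 0` on `Cay(ℤ^d; S)` for EVERY `d ≥ 2` and every symmetric finite `S ∋ ±e_i` of unit range in two coordinates and arbitrary range in
# the others, invariant under one coordinate reflection — the all-dimensions form of the unit-range / tall-generator rows, from the abstract theorem

builds on p205010 (kernel theorem, internal audit signed; external expert review pending) — `Zd.criticalContinuity` runs through the closed D″ node
via `CayleySign.criticalContinuity`, whose proof uses near-one gluing (AdditiveGluing), which builds on p205010.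
Lane `prim-bschramm`, seat `prim-bschramm-p4` (gen 9; PART C3, METHOD = abstract closing argument); helper file
(`--supports stmt-CriticalPhenomena-4575 --as helper`).  Memo `HOME/bschramm/P4-GENERAL.md` §25.5.  Sibling of `CayleySkeletonAbelian`.

THE POINT.  p4-g7's `Z3UnitGens*` (all 1,024 unit-range `Cay(ℤ³;S)`) and p2-g11's `Z3TallGens*` (unit PLANAR range, arbitrary vertical range) are
the `d = 3` rows of one statement that the abstract Cayley theorem proves for every `d` at once: on `ℤ^{d}` (`d = n + 2`), skeleton `φ = (x₀, x₁)`,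
inversion `−id`, axis flip `x₁ ↦ −x₁`, translating element `e₀`, kernel `ker φ = ⟨e₂, …, e_{d−1}⟩` generated by axes in `S`.  **THEOREM
(`Zd.criticalContinuity`): for every `n`, every finite `S ⊆ ℤ^{n+2}` with `S = −S`, `|s₀|, |s₁| ≤ 1` on `S`, all `±e_i ∈ S`, and `S` invariant
under `x₁ ↦ −x₁`: `θ_v(p_c) = 0` at every vertex of `Cay(ℤ^{n+2}; S)` (additive Cayley graph), unconditionally.**  `n = 0`: the square lattice and
the king's graph; `n = 1`: the flip-symmetric unit-range and tall rows; `n ≥ 2`: new (long-range bonds in `n` directions).  Without the flip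
hypothesis the same data give `θ(p_c) = 0` modulo the N1 node (`Zd.criticalContinuity_of_negNode₁`).
* §1 `Zd.φ`, `Zd.flip₁`, kernel generation `Zd.mem_closure_of_φ_eq_zero`; §2 `Zd.neg`/`Zd.sign`, **`Zd.criticalContinuity`**, `Zd.criticalContinuity_of_negNode₁`.
[cite: BenjaminiSchramm1996, Conj. 4; §2 (Cayley graphs)] [cite: GrimmettPercolation1999, §12.1 p. 349 (general lattices)]
[cite: KozmaNitzan2024, §4 p. 16 (Lemma 8: the lattice symmetries)]
-/

noncomputable section

namespace Summit.CriticalPhenomena.PercolationContinuityZ3.Theorems.Transplant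

open MeasureTheory Literature.Probability.Percolation Literature.Probability.LatticeModels SimpleGraph
open scoped Classical

namespace Zd

variable {n : ℕ}

/-! ## §1 Skeleton, flip and kernel on `ℤ^{n+2}` -/

/-- The skeleton `φ = (x₀, x₁)` read on `Multiplicative ℤ^{n+2}`. [cite: KozmaNitzan2024, §4 p. 15 (boxes)] -/
def φ (g : Multiplicative (Site (n + 2))) : Site 2 := ![Multiplicative.toAdd g 0, Multiplicative.toAdd g 1]

/-- `φ` at coordinate `0`. [folklore] -/
@[simp] theorem φ_apply_zero (g : Multiplicative (Site (n + 2))) : φ g 0 = Multiplicative.toAdd g 0 := rfl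
/-- `φ` at coordinate `1`. [folklore] -/
@[simp] theorem φ_apply_one (g : Multiplicative (Site (n + 2))) : φ g 1 = Multiplicative.toAdd g 1 := rfl

/-- `φ` is a homomorphism. [folklore] -/
theorem φ_mul (g h : Multiplicative (Site (n + 2))) : φ (g * h) = φ g + φ h := by
  funext j; fin_cases j <;> simp [toAdd_mul]

/-- `φ g = 0` iff `x₀ = x₁ = 0`. [folklore] -/
theorem φ_eq_zero_iff (g : Multiplicative (Site (n + 2))) : φ g = 0 ↔ Multiplicative.toAdd g 0 = 0 ∧ Multiplicative.toAdd g 1 = 0 := by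
  constructor
  · intro h; exact ⟨by simpa using congrFun h 0, by simpa using congrFun h 1⟩
  · rintro ⟨h0, h1⟩; funext j; fin_cases j <;> simp [h0, h1]

/-- The coordinate reflection `x₁ ↦ −x₁` of `ℤ^{n+2}`. [folklore] -/
def flip₁ : Site (n + 2) ≃+ Site (n + 2) where
  toFun v := Function.update v 1 (-v 1)
  invFun v := Function.update v 1 (-v 1)
  left_inv v := by
    funext i
    by_cases h : i = 1
    · subst h; simp
    · simp [Function.update_of_ne h]
  right_inv v := by
    funext i
    by_cases h : i = 1
    · subst h; simp
    · simp [Function.update_of_ne h]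
  map_add' v w := by
    funext i
    by_cases h : i = 1
    · subst h; simp; ring
    · simp [Function.update_of_ne h]

/-- `flip₁` at coordinate `1`. [folklore] -/
@[simp] theorem flip₁_apply_one (v : Site (n + 2)) : flip₁ v 1 = -v 1 := by
  show Function.update v 1 (-v 1) 1 = -v 1; simp

/-- `flip₁` away from coordinate `1`. [folklore] -/
theorem flip₁_apply_of_ne (v : Site (n + 2)) {i : Fin (n + 2)} (h : i ≠ 1) : flip₁ v i = v i := by
  show Function.update v 1 (-v 1) i = v i; rw [Function.update_of_ne h]

/-- `flip₁` is an involution. [folklore] -/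
theorem flip₁_flip₁ (v : Site (n + 2)) : flip₁ (flip₁ v) = v := flip₁.left_inv v

/-- `φ ∘ flip₁ = flipSnd ∘ φ`. [folklore] -/
theorem φ_flip₁ (g : Multiplicative (Site (n + 2))) :
    φ ((AddEquiv.toMultiplicative flip₁) g) = flipSnd (φ g) := by
  funext j
  fin_cases j
  · show flip₁ (Multiplicative.toAdd g) 0 = flipSnd (φ g) 0
    rw [flip₁_apply_of_ne _ Fin.zero_ne_one, flipSnd_apply_zero]; rfl
  · show flip₁ (Multiplicative.toAdd g) 1 = flipSnd (φ g) 1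
    rw [flip₁_apply_one, flipSnd_apply_one]; rfl

/-- An integer multiple of a basis vector. [folklore] -/
theorem single_eq_zsmul (i : Fin (n + 2)) (k : ℤ) : (Pi.single i k : Site (n + 2)) = k • Pi.single i 1 := by
  funext j
  by_cases h : j = i
  · subst h; simp
  · simp [Pi.single_eq_of_ne h]

/-- **Kernel generation**: if all axes `e_i` lie in `S`, every `g` with `φ g = 0` lies in the subgroup generated by the generators of skeleton
value `0` (`g = Σ_{i ≥ 2} g_i e_i`). [folklore] -/
theorem mem_closure_of_φ_eq_zero (S : Finset (Site (n + 2))) (axes : ∀ i : Fin (n + 2), (Pi.single i 1 : Site (n + 2)) ∈ S)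
    (g : Multiplicative (Site (n + 2))) (hg : φ g = 0) :
    g ∈ Subgroup.closure (↑((mulGens S).filter fun s => φ s = 0) : Set (Multiplicative (Site (n + 2)))) := by
  obtain ⟨h0, h1⟩ := (φ_eq_zero_iff g).1 hg
  set H := Subgroup.closure (↑((mulGens S).filter fun s => φ s = 0) : Set (Multiplicative (Site (n + 2))))
  have e : g = Multiplicative.ofAdd (∑ i, Pi.single i (Multiplicative.toAdd g i)) := by
    rw [Finset.univ_sum_single]; rfl
  rw [e, ofAdd_sum]
  refine Subgroup.prod_mem H fun i _ => ?_
  by_cases hi0 : i = 0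
  · subst hi0; rw [h0, Pi.single_zero, ofAdd_zero]; exact H.one_mem
  by_cases hi1 : i = 1
  · subst hi1; rw [h1, Pi.single_zero, ofAdd_zero]; exact H.one_mem
  rw [single_eq_zsmul, ofAdd_zsmul]
  refine H.zpow_mem (Subgroup.subset_closure (Finset.mem_coe.2 (Finset.mem_filter.2 ⟨?_, ?_⟩))) _
  · rw [mem_mulGens]; exact axes i
  · exact (φ_eq_zero_iff _).2 ⟨by simp [Pi.single_eq_of_ne (Ne.symm hi0)], by simp [Pi.single_eq_of_ne (Ne.symm hi1)]⟩

/-! ## §2 The structures and the theorems -/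

variable (S : Finset (Site (n + 2))) (symm : ∀ s ∈ S, -s ∈ S) (unit : ∀ s ∈ S, |s 0| ≤ 1 ∧ |s 1| ≤ 1)
  (axes : ∀ i : Fin (n + 2), (Pi.single i 1 : Site (n + 2)) ∈ S)

/-- Symmetric `S` read multiplicatively is closed under inversion. [folklore] -/
theorem inv_mem_iff (symm : ∀ s ∈ S, -s ∈ S) (s : Multiplicative (Site (n + 2))) : s⁻¹ ∈ mulGens S ↔ s ∈ mulGens S := by
  rw [mem_mulGens, mem_mulGens, toAdd_inv]
  refine ⟨fun h => ?_, fun h => symm _ h⟩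
  have h' := symm _ h
  rwa [neg_neg] at h'

/-- Unit range in the two skeleton coordinates. [folklore] -/
theorem lip (unit : ∀ s ∈ S, |s 0| ≤ 1 ∧ |s 1| ≤ 1) : ∀ s ∈ mulGens S, ∀ i : Fin 2, |φ s i| ≤ 1 := by
  intro s hs i
  rw [mem_mulGens] at hs
  fin_cases i
  · exact (unit _ hs).1
  · exact (unit _ hs).2

/-- Unit steps `e₀`, `e₁`. [folklore] -/
theorem step (axes : ∀ i : Fin (n + 2), (Pi.single i 1 : Site (n + 2)) ∈ S) :
    ∀ i : Fin 2, ∃ s ∈ mulGens S, φ s = Pi.single i 1 := by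
  intro i
  fin_cases i
  · refine ⟨Multiplicative.ofAdd (Pi.single 0 1), by rw [mem_mulGens]; exact axes 0, ?_⟩
    funext j; fin_cases j
    · show (Pi.single (0 : Fin (n + 2)) (1 : ℤ) : Site (n + 2)) 0 = _; simp
    · show (Pi.single (0 : Fin (n + 2)) (1 : ℤ) : Site (n + 2)) 1 = _; simp
  · refine ⟨Multiplicative.ofAdd (Pi.single 1 1), by rw [mem_mulGens]; exact axes 1, ?_⟩
    funext j; fin_cases j
    · show (Pi.single (1 : Fin (n + 2)) (1 : ℤ) : Site (n + 2)) 0 = _; simp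
    · show (Pi.single (1 : Fin (n + 2)) (1 : ℤ) : Site (n + 2)) 1 = _; simp

/-- **`Cay(ℤ^{n+2}; S)` carries a `CayleyNeg`** for every symmetric `S ∋ ±e_i` of unit range in `x₀, x₁` (inversion, `z = e₀`, kernel by axes).
[cite: KozmaNitzan2024, §4 p. 16 (Lemma 8)] -/
def neg (symm : ∀ s ∈ S, -s ∈ S) (unit : ∀ s ∈ S, |s 0| ≤ 1 ∧ |s 1| ≤ 1)
    (axes : ∀ i : Fin (n + 2), (Pi.single i 1 : Site (n + 2)) ∈ S) : CayleyNeg (Multiplicative (Site (n + 2))) (mulGens S) :=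
  CayleyNeg.ofComm φ φ_mul (lip S unit) (step S axes) (inv_mem_iff S symm) (mem_closure_of_φ_eq_zero S axes)

/-- **… and a `CayleySign`** when `S` is invariant under `x₁ ↦ −x₁`. [cite: KozmaNitzan2024, §4 p. 16 (Lemma 8)] -/
def sign (symm : ∀ s ∈ S, -s ∈ S) (unit : ∀ s ∈ S, |s 0| ≤ 1 ∧ |s 1| ≤ 1)
    (axes : ∀ i : Fin (n + 2), (Pi.single i 1 : Site (n + 2)) ∈ S) (flip : ∀ s ∈ S, flip₁ s ∈ S) :
    CayleySign (Multiplicative (Site (n + 2))) (mulGens S) :=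
  CayleySign.ofComm φ φ_mul (lip S unit) (step S axes) (inv_mem_iff S symm) (mem_closure_of_φ_eq_zero S axes)
    (AddEquiv.toMultiplicative flip₁)
    (fun s => by
      rw [mem_mulGens, mem_mulGens]
      show flip₁ (Multiplicative.toAdd s) ∈ S ↔ Multiplicative.toAdd s ∈ S
      refine ⟨fun h => ?_, fun h => flip _ h⟩
      have h' := flip _ h
      rwa [flip₁_flip₁] at h')
    φ_flip₁

/-- **THEOREM: `θ_v(p_c) = 0` at every vertex of `Cay(ℤ^{n+2}; S)`** for every symmetric finite `S ∋ ±e_i` of unit range in `x₀, x₁`, invariant under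
`x₁ ↦ −x₁` — every dimension, arbitrary range in the other `n` coordinates; unconditional (closed D″ node).
builds on p205010 (kernel theorem, internal audit signed; external expert review pending). [cite: BenjaminiSchramm1996, Conj. 4; §2] -/
theorem criticalContinuity (symm : ∀ s ∈ S, -s ∈ S) (unit : ∀ s ∈ S, |s 0| ≤ 1 ∧ |s 1| ≤ 1)
    (axes : ∀ i : Fin (n + 2), (Pi.single i 1 : Site (n + 2)) ∈ S) (flip : ∀ s ∈ S, flip₁ s ∈ S) (v : Site (n + 2)) :
    theta (addCayley (S : Set (Site (n + 2)))) v (criticalProbIOf (addCayley (S : Set (Site (n + 2)))) v) = 0 :=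
  theta_addCayley_criticalProb_eq_zero S v ((sign S symm unit axes flip).criticalContinuity (Multiplicative.ofAdd v))

/-- **CONDITIONAL THEOREM (N1): the same without the flip hypothesis**, modulo `SamePDropOfSkeletonNeg₁`. [cite: BenjaminiSchramm1996, Conj. 4; §2] -/
theorem criticalContinuity_of_negNode₁ (hD : SamePDropOfSkeletonNeg₁) (symm : ∀ s ∈ S, -s ∈ S) (unit : ∀ s ∈ S, |s 0| ≤ 1 ∧ |s 1| ≤ 1)
    (axes : ∀ i : Fin (n + 2), (Pi.single i 1 : Site (n + 2)) ∈ S) (v : Site (n + 2)) :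
    theta (addCayley (S : Set (Site (n + 2)))) v (criticalProbIOf (addCayley (S : Set (Site (n + 2)))) v) = 0 :=
  theta_addCayley_criticalProb_eq_zero S v ((neg S symm unit axes).criticalContinuity_of_negNode₁ hD (Multiplicative.ofAdd v))

end Zd

end Summit.CriticalPhenomena.PercolationContinuityZ3.Theorems.Transplant

end
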